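import Literature.IUT.HodgeTheaters.InitialThetaDataLocalGroupsProofs
import Literature.IUT.HodgeTheaters.InitialThetaDataLocalGaloisProofs
import HarnessLib

/-!
# [IUTchI] Def. 3.1 (e), (f) at a finite place `w` of `K`: `Π_{(−)_w} ≅ Π_{(−)} ∩ augGF⁻¹(G_w)` (proofs)

`Proofs` companion (theorems only) of `InitialThetaDataLocalGroups(Proofs).lean` and
`InitialThetaDataLocalGaloisProofs.lean` (abc-iut-L5-t2). S. Mochizuki, *Inter-universal Teichmüller theory I*, Def. 3.1
(e), (f) (kurims May-2020 manuscript pp. 62–63) [claim: Mochizuki2012, status: disputed]. At a finite place `w` of the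
number field `K` the restriction `ρ := localToGF F K_w ι : Gal(K̄_w/K_w) → G_F` is INJECTIVE (Krasner density,
`localToGF_injective_adicCompletion`), so the base change `Π_{(−)_w} := Π_{(−)} ×_{G_F} Gal(K̄_w/K_w)` of
`InitialThetaDataLocalGroups.lean` embeds into `Π_{(−)}` (`fstLoc_injective_adicCompletion`, the "injections of profinite
groups" of (e)) with image the decomposition subgroup `Π_{(−)} ∩ augGF⁻¹(G_w)`
(`nonempty_mulEquiv_PiLoc_decomposition_adicCompletion`); for `Π_{(−)} = Π_{X̲→_K}` this is print's
`Π_v̲ := Π_{X̲→_v̲} ⊆ Π_{X̲→_K}` (f). Nothing of the disputed series is asserted; no side is taken.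
-/

noncomputable section

namespace Literature.IUT.HodgeTheaters

universe u v w

namespace InitialThetaData

/-! ### At a finite place `w` of `K`: `Π_{(−)_w} ≅ Π_{(−)} ∩ augGF⁻¹(G_w)` -/

section Place

open IsDedekindDomain NumberField

variable {F : Type u} {K : Type v} {Fbar : Type w} [Field F] [NumberField F] [Field K] [NumberField K]
  [Algebra F K] [Field Fbar] [Algebra F Fbar] [Algebra K Fbar] [IsScalarTower F K Fbar] [Normal K Fbar]
  [IsAlgClosed Fbar] {E : WeierstrassCurve F} [E.IsElliptic] {l : ℕ} {Pb : BadPlacePredicates K}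
  (D : InitialThetaData F K Fbar E l Pb) (H : Subgroup D.PiC) (w : HeightOneSpectrum (𝓞 K))
  (ι : Fbar →ₐ[K] AlgebraicClosure (w.adicCompletion K))

/-- **`Π_{(−)_w} ↪ Π_{(−)}`** at a finite place `w` of `K` (`Γ := Gal(K̄_w/K_w)`, injective restriction
`localToGF_injective_adicCompletion`): the "injections of profinite groups" of Def. 3.1 (e), local-to-global.
[claim: Mochizuki2012, status: disputed] -/
theorem fstLoc_injective_adicCompletion :
    Function.Injective (D.fstLoc H (localToGF F (w.adicCompletion K) ι)) :=
  D.fstLoc_injective H _ (localToGF_injective_adicCompletion w ι F)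

/-- **`Π_{(−)_w} ≅ Π_{(−)} ∩ augGF⁻¹(G_w)`** at a finite place `w` of `K`: the base change
`Π_{(−)} ×_{G_F} Gal(K̄_w/K_w)` IS the decomposition subgroup of `w` in `Π_{(−)}` (`G_w = decompositionSubgroupGF`,
the image of `Gal(K̄_w/K_w) ↪ G_K`); for `H = Π_{X̲→_K}` this is print's `Π_v̲ := Π_{X̲→_v̲} ⊆ Π_{X̲→_K}`
(Def. 3.1 (e)(f)). [claim: Mochizuki2012, status: disputed] -/
theorem nonempty_mulEquiv_PiLoc_decomposition_adicCompletion :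
    Nonempty (D.PiLoc H (localToGF F (w.adicCompletion K) ι) ≃*
      (H ⊓ (decompositionSubgroupGF F (w.adicCompletion K) ι).comap D.augGF : Subgroup D.PiC)) :=
  D.nonempty_mulEquiv_PiLoc_inf H _ (localToGF_injective_adicCompletion w ι F)

end Place

end InitialThetaData

end Literature.IUT.HodgeTheaters

end
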